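import Literature.NumberTheory.Automorphic.TwistedQuotientConeClass
import Literature.Geometry.Kaehler.PoincareLemmaStarConvex
import HarnessLib

/-!
# Descent of an equivariant closed form with vanishing cone class to an INVARIANT primitive:
# the double-complex staircase on a convex cone (definitions)

Topic `NumberTheory/Automorphic`; namespace `Literature.NumberTheory.Automorphic.TwistedQuotient`
(the generic layer of `TwistedQuotientConeClass`: `ι : Γ →* 𝒢`, a level `L ≤ 𝒢`, twisted
coefficients `ρ : Γ → GL(V)`, a linear action `a : Γ →* (W →L[ℝ] W)` preserving an open convex
`X ⊆ W`, base point `x₀ ∈ X`).  DEFINITIONS with bodies and unfolding lemmas only; the identities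
(`δδ = 0`, `dK + Kd = 1`, `δS + Sδ = 1`, equivariance, the descent theorem, growth) follow in the
sequel files of the line `Sketch` of crux `HeckeEigenvalueField`.

**Purpose.**  `TwistedQuotient.coneClass hω hx₀ ∈ H^q(Γ, Fun(𝒢 ⧸ L, V))` is the class of the cone
periods of an equivariant family `ω` of closed `q`-forms.  When it VANISHES, the cone cocycle is a
coboundary of a group cochain `b` (`coneClass_eq_zero_iff`), and `ω` admits an INVARIANT primitive
`β`, `dβ = ω`, obtained by the staircase of the double complex
`C^{p,r} = {equivariant homogeneous p-cochains of Γ with values in families of r-forms on X}`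
(rows: the simplicial coboundary `δ`; columns: the exterior derivative `d`), whose column homotopy is
the radial homotopy operator `K` of the tree (`Literature.Geometry.Kaehler.coneOperator`, Poincaré
lemma on star-shaped opens) centred at a vertex of the simplex, and whose row homotopy `S` is a
`Γ`-partition of unity `ψ` (`∑_γ ψ ∘ a(γ)⁻¹ = 1`, locally finite):
`κ⁽⁰⁾ = K ω`, `κ⁽ᵖ⁺¹⁾ = K δκ⁽ᵖ⁾` (`dκ⁽ᵖ⁺¹⁾ = δκ⁽ᵖ⁾`; `δκ⁽q⁾` is the cone cocycle), then downwards
`λ_q = κ⁽q⁾ - b`, `λ_{p} = κ⁽ᵖ⁾ - T(λ_{p+1}, κ⁽ᵖ⁾)` with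
`T(λ, κ) = ∑_γ dψ_γ ∧ λ(γ, ·) + ψ_γ · (δκ)(γ, ·)` (`= d(Sλ)` when `dλ = δκ`), ending with the
invariant `β = λ₀`, `dβ = dκ⁽⁰⁾ = ω` [cite: Dupont1976, §1–2] [cite: BottTu1982Forms, §I.4 and §II.8–9]
(the Čech–de Rham / simplicial de Rham double complex; here for a discrete group acting on a
contractible convex set).  Because `K` and `S` are EXPLICIT, growth estimates propagate through the
staircase ("self-regularising coboundaries": a coboundary has a primitive of moderate growth without
any regularisation theorem) — the use made of it in Borel's injectivity of cuspidal cohomology.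

To avoid dependent degree arithmetic all objects are TOTAL form families
`α : (𝒢 ⧸ L) → (r : ℕ) → W → W [⋀^Fin r]→L[ℝ] V` (a form in every degree; the staircase objects
are concentrated in one degree): `famD` raises and `famK` lowers the degree by one.

## Contents (definitions)

* `TFam L W V` — total form families; `ρCLM`, `famAct` — the `Γ`-action
  `(γ • α)(c)(x) = ρ(γ) ∘ α(ι γ⁻¹ • c)(a γ⁻¹ x) ∘ ∧ a γ⁻¹`;
* `famD` (exterior derivative, degreewise), `famK y` (radial homotopy operator centred at `y`),
  `wedgeD f` (`df ∧ ·`, the Leibniz term);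
* `Coch L W V p` — homogeneous `p`-cochains `(Fin (p+1) → Γ) → TFam`; `IsEquivariant`; `delta`
  (simplicial coboundary); `cochD`, `cochK x₀` (columns: `K` centred at the LAST vertex `a(g_p) x₀`),
  `cochS ψ` (rows: `(Sφ)(g) = ∑ᶠ_γ (ψ ∘ a γ⁻¹) · φ(γ, g)`), `cochT ψ` (the descent correction);
* `stair ω x₀ : (p : ℕ) → Coch p` — the staircase `κ⁽⁰⁾ = K ω`, `κ⁽ᵖ⁺¹⁾ = K δκ⁽ᵖ⁾`.

## References

* J. L. Dupont, *Simplicial de Rham cohomology and characteristic classes of flat bundles*, Topology 15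
  (1976), §1–2. [Dupont1976]
* R. Bott, L. W. Tu, *Differential Forms in Algebraic Topology*, GTM 82 (1982), §I.4 (homotopy
  operator), §II.8–9 (the Čech–de Rham double complex, the staircase / collating formula). [BottTu1982Forms]
* A. Borel, N. Wallach, *Continuous cohomology, discrete subgroups, and representations of reductive
  groups*, 2nd ed. (2000), VII 2.2. [BorelWallach2000]
-/

noncomputable section

open CategoryTheory Set MeasureTheory
open Literature.Analysis.Calculus Literature.Geometry.Kaehler

namespace Literature.NumberTheory.Automorphic

namespace TwistedQuotient

/-! ### Total form families and the `Γ`-action -/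

/-- **Total form families**: for every finite-adelic coset `c`, every degree `r` and every point `x`
an alternating `r`-form `α c r x` on `W` with values in `V`. [cite: BottTu1982Forms, §II.8] -/
abbrev TFam {𝒢 : Type} [Group 𝒢] (L : Subgroup 𝒢) (W V : Type) [NormedAddCommGroup W] [NormedSpace ℝ W]
    [NormedAddCommGroup V] [NormedSpace ℂ V] : Type :=
  (𝒢 ⧸ L) → (r : ℕ) → W → W [⋀^Fin r]→L[ℝ] V

variable {Γ 𝒢 : Type} [Group Γ] [Group 𝒢] (ι : Γ →* 𝒢) (L : Subgroup 𝒢)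
  {V : Type} [NormedAddCommGroup V] [NormedSpace ℂ V]
  (ρ : Representation ℂ Γ V)
  {W : Type} [NormedAddCommGroup W] [NormedSpace ℝ W]
  (a : Γ →* (W →L[ℝ] W))

section Action

variable [FiniteDimensional ℂ V]

/-- The coefficient operator `ρ γ` as a REAL continuous linear map (finite-dimensionality of `V`).
[folklore] -/
def ρCLM (γ : Γ) : V →L[ℝ] V :=
  LinearMap.toContinuousLinearMap ((ρ γ).restrictScalars ℝ)

/-- Unfolding. [folklore] -/
@[simp]
theorem ρCLM_apply (γ : Γ) (v : V) : ρCLM ρ γ v = ρ γ v :=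
  rfl

/-- **The `Γ`-action on total form families**:
`(γ • α)(c)(r)(x) = ρ(γ) ∘ α(ι γ⁻¹ • c)(r)(a γ⁻¹ x) ∘ ∧^r (a γ⁻¹)` — an `IsConeFormFamily` is exactly a
family fixed by every `γ` (on `X`). [cite: BorelWallach2000, VII 2.2] [cite: Dupont1976, §1–2] -/
def famAct (γ : Γ) (α : TFam L W V) : TFam L W V :=
  fun c r x => (ρCLM ρ γ).compContinuousAlternatingMap
    ((α ((ι γ)⁻¹ • c) r (a γ⁻¹ x)).compContinuousLinearMap (a γ⁻¹))

/-- Unfolding. [folklore] -/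
theorem famAct_apply (γ : Γ) (α : TFam L W V) (c : 𝒢 ⧸ L) (r : ℕ) (x : W) (v : Fin r → W) :
    famAct ι L ρ a γ α c r x v = ρ γ (α ((ι γ)⁻¹ • c) r (a γ⁻¹ x) fun i => a γ⁻¹ (v i)) :=
  rfl

end Action

/-! ### Columns: exterior derivative, radial homotopy operator, Leibniz term -/

/-- **The exterior derivative on total families** (degreewise Mathlib `extDeriv`; nothing in degree
`0`). [cite: BottTu1982Forms, §I.1] -/
def famD (α : TFam L W V) : TFam L W V :=
  fun c r => match r with
    | 0 => 0
    | r + 1 => extDeriv (α c r)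

/-- Unfolding in positive degree. [folklore] -/
@[simp]
theorem famD_succ (α : TFam L W V) (c : 𝒢 ⧸ L) (r : ℕ) : famD L α c (r + 1) = extDeriv (α c r) :=
  rfl

/-- Unfolding in degree `0`. [folklore] -/
@[simp]
theorem famD_zero (α : TFam L W V) (c : 𝒢 ⧸ L) : famD L α c 0 = 0 :=
  rfl

/-- **The radial homotopy operator on total families**, centred at `y`:
`(K_y α)(c)(r) = coneOperator y (α c (r+1))` — the degree-`r` part of `K_y α` is the radial primitive of
the degree-`(r+1)` part of `α`. [cite: BottTu1982Forms, §I.4] -/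
def famK (y : W) (α : TFam L W V) : TFam L W V :=
  fun c r => coneOperator y (α c (r + 1))

/-- Unfolding. [folklore] -/
@[simp]
theorem famK_apply (y : W) (α : TFam L W V) (c : 𝒢 ⧸ L) (r : ℕ) :
    famK L y α c r = coneOperator y (α c (r + 1)) :=
  rfl

/-- **The Leibniz term `df ∧ α`** of a scalar function `f` against a total family (degreewise the
alternatisation of `v ↦ df(x)(v) • α(c)(r)(x)`; so that `d(f • α) = df ∧ α + f • dα` pointwise).
[cite: BottTu1982Forms, §I.1] -/
def wedgeD (f : W → ℝ) (α : TFam L W V) : TFam L W V :=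
  fun c r x => match r with
    | 0 => 0
    | r + 1 => ContinuousAlternatingMap.alternatizeUncurryFin ((fderiv ℝ f x).smulRight (α c r x))

/-- Unfolding in positive degree. [folklore] -/
@[simp]
theorem wedgeD_succ (f : W → ℝ) (α : TFam L W V) (c : 𝒢 ⧸ L) (r : ℕ) (x : W) :
    wedgeD L f α c (r + 1) x =
      ContinuousAlternatingMap.alternatizeUncurryFin ((fderiv ℝ f x).smulRight (α c r x)) :=
  rfl

/-- Unfolding in degree `0`. [folklore] -/
@[simp]
theorem wedgeD_zero (f : W → ℝ) (α : TFam L W V) (c : 𝒢 ⧸ L) (x : W) : wedgeD L f α c 0 x = 0 :=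
  rfl

/-! ### Rows: homogeneous cochains, the simplicial coboundary, the partition-of-unity contraction -/

/-- **Homogeneous `p`-cochains** of `Γ` with values in total form families. [cite: Dupont1976, §1–2] -/
abbrev Coch {𝒢 : Type} [Group 𝒢] (Γ : Type) (L : Subgroup 𝒢) (W V : Type) [NormedAddCommGroup W]
    [NormedSpace ℝ W] [NormedAddCommGroup V] [NormedSpace ℂ V] (p : ℕ) : Type :=
  (Fin (p + 1) → Γ) → TFam L W V

/-- **Equivariance** of a homogeneous cochain: `φ(γ g₀, …, γ g_p) = γ • φ(g₀, …, g_p)`.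
[cite: Dupont1976, §1–2] -/
def IsEquivariant [FiniteDimensional ℂ V] {p : ℕ} (φ : Coch Γ L W V p) : Prop :=
  ∀ (γ : Γ) (g : Fin (p + 1) → Γ), φ (fun i => γ * g i) = famAct ι L ρ a γ (φ g)

/-- **The simplicial coboundary** `(δφ)(g₀, …, g_{p+1}) = ∑ᵢ (-1)ⁱ φ(g₀, …, ĝᵢ, …, g_{p+1})`.
[cite: Brown1982CohomologyGroups, III §1] -/
def delta {p : ℕ} (φ : Coch Γ L W V p) : Coch Γ L W V (p + 1) :=
  fun g => ∑ i : Fin (p + 2), ((-1 : ℝ) ^ (i : ℕ)) • φ fun j => g (i.succAbove j)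

omit [Group Γ] in
/-- Unfolding. [folklore] -/
theorem delta_apply {p : ℕ} (φ : Coch Γ L W V p) (g : Fin (p + 2) → Γ) :
    delta L φ g = ∑ i : Fin (p + 2), ((-1 : ℝ) ^ (i : ℕ)) • φ fun j => g (i.succAbove j) :=
  rfl

/-- **The exterior derivative on cochains** (pointwise in the group variables). [folklore] -/
def cochD {p : ℕ} (φ : Coch Γ L W V p) : Coch Γ L W V p :=
  fun g => famD L (φ g)

omit [Group Γ] in
/-- Unfolding. [folklore] -/
@[simp]
theorem cochD_apply {p : ℕ} (φ : Coch Γ L W V p) (g : Fin (p + 1) → Γ) : cochD L φ g = famD L (φ g) :=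
  rfl

/-- **The column homotopy on cochains**: the radial homotopy operator centred at the LAST vertex
`a(g_p) x₀` (the equivariant choice: `a` is linear and `K` commutes with linear maps on the nose).
[cite: Dupont1976, §1–2] [cite: BottTu1982Forms, §I.4] -/
def cochK (x₀ : W) {p : ℕ} (φ : Coch Γ L W V p) : Coch Γ L W V p :=
  fun g => famK L (a (g (Fin.last p)) x₀) (φ g)

/-- Unfolding. [folklore] -/
@[simp]
theorem cochK_apply (x₀ : W) {p : ℕ} (φ : Coch Γ L W V p) (g : Fin (p + 1) → Γ) :
    cochK L a x₀ φ g = famK L (a (g (Fin.last p)) x₀) (φ g) :=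
  rfl

/-- **The row contraction** by a `Γ`-partition of unity `ψ`:
`(Sφ)(g₀, …, g_{p-1})(c)(r)(x) = ∑ᶠ_γ ψ(a γ⁻¹ x) • φ(γ, g₀, …, g_{p-1})(c)(r)(x)` (a locally finite sum;
`finsum`, junk `0` where infinite). [cite: BottTu1982Forms, §II.8 (the collating formula)]
[cite: Dupont1976, §1–2] -/
def cochS (ψ : W → ℝ) {p : ℕ} (φ : Coch Γ L W V (p + 1)) : Coch Γ L W V p :=
  fun g c r x => ∑ᶠ γ : Γ, ψ (a γ⁻¹ x) • φ (Fin.cons γ g) c r x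

/-- Unfolding. [folklore] -/
theorem cochS_apply (ψ : W → ℝ) {p : ℕ} (φ : Coch Γ L W V (p + 1)) (g : Fin (p + 1) → Γ)
    (c : 𝒢 ⧸ L) (r : ℕ) (x : W) :
    cochS L a ψ φ g c r x = ∑ᶠ γ : Γ, ψ (a γ⁻¹ x) • φ (Fin.cons γ g) c r x :=
  rfl

/-- **The descent correction** `T_ψ(λ, κ)(g) = ∑ᶠ_γ d(ψ ∘ a γ⁻¹) ∧ λ(γ, g) + (ψ ∘ a γ⁻¹) • (δκ)(γ, g)`:
when `dλ = δκ` it is `d(S_ψ λ)` (Leibniz), but written WITHOUT differentiating `λ`, so that growth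
bounds on `λ, δκ, ψ, dψ` alone control it (self-regularisation). [cite: BottTu1982Forms, §II.9] -/
def cochT (ψ : W → ℝ) {p : ℕ} (lam : Coch Γ L W V (p + 1)) (κ : Coch Γ L W V p) : Coch Γ L W V p :=
  fun g c r x => ∑ᶠ γ : Γ,
    (wedgeD L (fun y => ψ (a γ⁻¹ y)) (lam (Fin.cons γ g)) c r x +
      ψ (a γ⁻¹ x) • delta L κ (Fin.cons γ g) c r x)

/-- Unfolding. [folklore] -/
theorem cochT_apply (ψ : W → ℝ) {p : ℕ} (lam : Coch Γ L W V (p + 1)) (κ : Coch Γ L W V p)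
    (g : Fin (p + 1) → Γ) (c : 𝒢 ⧸ L) (r : ℕ) (x : W) :
    cochT L a ψ lam κ g c r x = ∑ᶠ γ : Γ,
      (wedgeD L (fun y => ψ (a γ⁻¹ y)) (lam (Fin.cons γ g)) c r x +
        ψ (a γ⁻¹ x) • delta L κ (Fin.cons γ g) c r x) :=
  rfl

/-! ### The staircase -/

/-- A single form family as a total family concentrated in degree `q`. [folklore] -/
def single {q : ℕ} (ω : (𝒢 ⧸ L) → W → W [⋀^Fin q]→L[ℝ] V) : TFam L W V :=
  fun c r => if h : r = q then h ▸ ω c else 0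

/-- In its own degree `single ω` is `ω`. [folklore] -/
@[simp]
theorem single_self {q : ℕ} (ω : (𝒢 ⧸ L) → W → W [⋀^Fin q]→L[ℝ] V) (c : 𝒢 ⧸ L) :
    single L ω c q = ω c := by
  simp [single]

/-- Off its degree `single ω` vanishes. [folklore] -/
theorem single_of_ne {q : ℕ} (ω : (𝒢 ⧸ L) → W → W [⋀^Fin q]→L[ℝ] V) (c : 𝒢 ⧸ L) {r : ℕ} (h : r ≠ q) :
    single L ω c r = 0 := by
  simp [single, h]

/-- **The staircase** of an (invariant, closed) family `ω`: `κ⁽⁰⁾(g₀) = K_{a(g₀)x₀} ω`,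
`κ⁽ᵖ⁺¹⁾ = K δκ⁽ᵖ⁾` — so `κ⁽ᵖ⁾(g₀, …, g_p) = ± K_{a(g_p)x₀} ⋯ K_{a(g₀)x₀} ω`, of form degree `q - p`
when `ω` has degree `q + 1`, and `dκ⁽ᵖ⁺¹⁾ = δκ⁽ᵖ⁾` on `X` (sequel). [cite: BottTu1982Forms, §II.9]
[cite: Dupont1976, §1–2] -/
def stair (ω : TFam L W V) (x₀ : W) : (p : ℕ) → Coch Γ L W V p
  | 0 => cochK L a x₀ fun _ => ω
  | p + 1 => cochK L a x₀ (delta L (stair ω x₀ p))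

/-- Unfolding, bottom step. [folklore] -/
@[simp]
theorem stair_zero (ω : TFam L W V) (x₀ : W) :
    stair L a ω x₀ 0 = cochK L a x₀ fun _ => ω :=
  rfl

/-- Unfolding, inductive step. [folklore] -/
@[simp]
theorem stair_succ (ω : TFam L W V) (x₀ : W) (p : ℕ) :
    stair L a ω x₀ (p + 1) = cochK L a x₀ (delta L (stair L a ω x₀ p)) :=
  rfl

end TwistedQuotient

end Literature.NumberTheory.Automorphic

end
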